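import Literature.Barriers.Parity.SiegelZeroDichotomyChowlaTypeI
import HarnessLib

/-!
# Step (v) of Tao–Teräväinen at `k = 0`, divisor sums: `∑_{d ≤ N} τ(d) (d,q)^{1/2}/d ≪ τ(q)² log² N`,
# `∑_{d ≤ N} τ(d) √d ≤ N^{3/2} (1 + log N)`, and the bound for the Type I expansion

Topic `Literature/Barriers/Parity`, sub-namespace `TaoTeravainen`; part of the proof DAG of
`Literature.Barriers.Parity.TaoTeravainen2021_chowla`, towards `TaoTeravainen2021_prop81_k0`
(Proposition 8.1 at `k = 0`). Everything here is PROVED: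

* `sum_card_divisors_mul_sqrt_gcd_div_le` — `∑_{d ≤ N} τ(d) √((d,q))/d ≤ τ(q)² (1 + log N)²`
  (write `d = g m`, `g = (d, q) ∣ q`; `τ(d) ≤ τ(g) τ(m)`; the tree's `∑_{m ≤ N} τ(m)/m ≤ (1+log N)²`),
  the source's "`∑_{d ∈ ℕ_(p)} (d,q_χ)^{1/2} τ(d)^{O(1)}/d ≤ 1 + O(1/p)` when `p ∤ q_χ` and `≪ 1`
  otherwise, thus … `≪ τ(q_χ)^{O(1)} log^{O(1)} x`" in elementary form;
* `sum_card_divisors_mul_sqrt_le` — `∑_{d ≤ N} τ(d) √d ≤ N √N (1 + log N)`;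
* `sqrt_gcd_prod_le_prod`, `sum_pi_prod_eq_pow` — `√((∏ d_h, q)) ≤ ∏ √((d_h, q))` and the
  factorisation `∑_{(d_h) ∈ S^H} ∏_h g(d_h) = (∑_{d ∈ S} g(d))^{#H}`;
* `abs_sum_prod_sharp_le` — combining these with the expansion of
  `SiegelZeroDichotomyChowlaTypeI.lean` and a Lemma 3.7–type bound `B` for the Type I sums:
  `|∑_{n ≤ x} ∏_h λ♯_Siegel(n+h)| ≤ M^ℓ B (x q^{-1} (τ(q)²(1+log N)²)^ℓ + (N√N(1+log N))^ℓ)`.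
  [cite: TaoTeravainen2021, §8 (the case ℓ > 0: (8.6) and the Euler product computation after it)]
-/

noncomputable section

open Finset
open Literature.NumberTheory.Sieve.Vaughan (card_divisors_mul_le sum_card_divisors_le
  sum_card_divisors_div_le)

namespace Literature.Barriers.Parity.TaoTeravainen

/-! ### `gcd` and products -/

/-- `(∏ f, q) ∣ ∏ (f, q)`. [folklore] -/
theorem gcd_prod_dvd_prod_gcd {ι : Type*} (s : Finset ι) (f : ι → ℕ) (q : ℕ) :
    Nat.gcd (∏ a ∈ s, f a) q ∣ ∏ a ∈ s, Nat.gcd (f a) q := by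
  classical
  induction s using Finset.induction_on with
  | empty => simp
  | insert a s ha ih =>
    rw [prod_insert ha, prod_insert ha]
    exact (Nat.gcd_mul_left_dvd_mul_gcd _ _ _).trans (Nat.mul_dvd_mul_left _ ih)

/-- `√((∏ d_h, q)) ≤ ∏ √((d_h, q))` for `q ≠ 0`. [folklore] -/
theorem sqrt_gcd_prod_le_prod {ι : Type*} (s : Finset ι) (f : ι → ℕ) {q : ℕ} (hq : q ≠ 0) :
    Real.sqrt (Nat.gcd (∏ a ∈ s, f a) q) ≤ ∏ a ∈ s, Real.sqrt (Nat.gcd (f a) q) := by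
  have hpos : 0 < ∏ a ∈ s, Nat.gcd (f a) q :=
    prod_pos fun a _ => Nat.pos_of_ne_zero (Nat.gcd_ne_zero_right hq)
  have h1 : (Nat.gcd (∏ a ∈ s, f a) q : ℝ) ≤ ∏ a ∈ s, (Nat.gcd (f a) q : ℝ) := by
    exact_mod_cast Nat.le_of_dvd hpos (gcd_prod_dvd_prod_gcd s f q)
  rw [← Real.sqrt_prod s fun a _ => Nat.cast_nonneg _]
  exact Real.sqrt_le_sqrt h1

/-- `√((P, q)) ≤ ∏ √(d_h)` for `P = ∏ d_h` with `d_h ≥ 1`. [folklore] -/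
theorem sqrt_gcd_prod_le_prod_sqrt {ι : Type*} (s : Finset ι) (f : ι → ℕ) (q : ℕ)
    (hf : ∀ a ∈ s, 1 ≤ f a) :
    Real.sqrt (Nat.gcd (∏ a ∈ s, f a) q) ≤ ∏ a ∈ s, Real.sqrt (f a) := by
  have hpos : 0 < ∏ a ∈ s, f a := prod_pos fun a ha => hf a ha
  have h1 : (Nat.gcd (∏ a ∈ s, f a) q : ℝ) ≤ ∏ a ∈ s, (f a : ℝ) := by
    exact_mod_cast Nat.le_of_dvd hpos (Nat.gcd_dvd_left _ _)
  rw [← Real.sqrt_prod s fun a _ => Nat.cast_nonneg _]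
  exact Real.sqrt_le_sqrt h1

/-- `∑_{(d_h) ∈ S^H} ∏_{h} g(d_h) = (∑_{d ∈ S} g(d))^{#H}` (`Finset.prod_sum` read backwards).
[folklore] -/
theorem sum_pi_prod_eq_pow (H : Finset ℕ) (S : Finset ℕ) (g : ℕ → ℝ) :
    ∑ p ∈ H.pi (fun _ => S), ∏ a ∈ H.attach, g (p a.1 a.2) = (∑ d ∈ S, g d) ^ #H := by
  classical
  rw [← prod_const, Finset.prod_sum H (fun _ => S) (fun _ d => g d)]

/-! ### The two divisor sums -/

/-- **`∑_{d ≤ N} τ(d) √((d,q))/d ≤ τ(q)² (1 + log N)²`** (`q ≠ 0`). [cite: TaoTeravainen2021, §8 (Euler product bound after (8.6))] -/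
theorem sum_card_divisors_mul_sqrt_gcd_div_le {q : ℕ} (hq : q ≠ 0) (N : ℕ) :
    ∑ d ∈ Ioc 0 N, (#d.divisors : ℝ) * Real.sqrt (Nat.gcd d q) / d ≤
      (#q.divisors : ℝ) ^ 2 * (1 + Real.log N) ^ 2 := by
  classical
  -- `d ↦ ((d, q), d/(d, q))`
  set φ : ℕ → ℕ × ℕ := fun d => (Nat.gcd d q, d / Nat.gcd d q) with hφ
  set G : ℕ × ℕ → ℝ := fun y => (#y.1.divisors : ℝ) / Real.sqrt y.1 * ((#y.2.divisors : ℝ) / y.2)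
    with hG
  have hG0 : ∀ y, 0 ≤ G y := fun y => by positivity
  have hdecomp : ∀ d : ℕ, Nat.gcd d q * (d / Nat.gcd d q) = d := fun d =>
    Nat.mul_div_cancel' (Nat.gcd_dvd_left d q)
  -- termwise comparison
  have hterm : ∀ d ∈ Ioc 0 N, (#d.divisors : ℝ) * Real.sqrt (Nat.gcd d q) / d ≤ G (φ d) := by
    intro d hd
    rw [mem_Ioc] at hd
    set g := Nat.gcd d q with hg
    set m := d / g with hm
    have hg0 : 0 < g := Nat.gcd_pos_of_pos_left q hd.1
    have hgm : g * m = d := hdecomp d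
    have hm0 : 0 < m := Nat.pos_of_ne_zero fun h => by rw [h, mul_zero] at hgm; omega
    have hg0' : (0 : ℝ) < g := by exact_mod_cast hg0
    have hm0' : (0 : ℝ) < m := by exact_mod_cast hm0
    have hsg : 0 < Real.sqrt g := Real.sqrt_pos.mpr hg0'
    have hτ : (#d.divisors : ℝ) ≤ (#g.divisors : ℝ) * #m.divisors := by
      rw [← hgm]; exact_mod_cast card_divisors_mul_le g m
    have hd' : (d : ℝ) = g * m := by rw [← hgm]; push_cast; ring
    simp only [hG, hφ]
    rw [← hg, ← hm, hd', div_le_iff₀ (by positivity)]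
    calc (#d.divisors : ℝ) * Real.sqrt g ≤ (#g.divisors : ℝ) * #m.divisors * Real.sqrt g :=
          mul_le_mul_of_nonneg_right hτ hsg.le
      _ = (#g.divisors : ℝ) / Real.sqrt g * ((#m.divisors : ℝ) / m) * (g * m) := by
          have hgg : Real.sqrt g * Real.sqrt g = g := Real.mul_self_sqrt hg0'.le
          set sg := Real.sqrt (g : ℝ) with hsgdef
          rw [← hgg]
          field_simp
  -- injectivity and range of `φ`
  have hinj : Set.InjOn φ (Ioc 0 N : Finset ℕ) := by
    intro a _ b _ hab
    simp only [hφ, Prod.mk.injEq] at hab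
    calc a = Nat.gcd a q * (a / Nat.gcd a q) := (hdecomp a).symm
      _ = Nat.gcd b q * (b / Nat.gcd b q) := by rw [hab.2, hab.1]
      _ = b := hdecomp b
  have hrange : (Ioc 0 N).image φ ⊆ q.divisors ×ˢ Ioc 0 N := by
    intro y hy
    rw [mem_image] at hy
    obtain ⟨d, hd, rfl⟩ := hy
    rw [mem_Ioc] at hd
    rw [mem_product, Nat.mem_divisors, mem_Ioc]
    have hg0 : 0 < Nat.gcd d q := Nat.gcd_pos_of_pos_left q hd.1
    refine ⟨⟨Nat.gcd_dvd_right d q, hq⟩, ?_, (Nat.div_le_self _ _).trans hd.2⟩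
    exact Nat.div_pos (Nat.le_of_dvd hd.1 (Nat.gcd_dvd_left d q)) hg0
  -- the sums over the factors
  have h1 : ∑ g ∈ q.divisors, (#g.divisors : ℝ) / Real.sqrt g ≤ (#q.divisors : ℝ) ^ 2 := by
    calc ∑ g ∈ q.divisors, (#g.divisors : ℝ) / Real.sqrt g ≤ ∑ _g ∈ q.divisors, (#q.divisors : ℝ) := by
          refine sum_le_sum fun g hg => ?_
          have hg1 : (1 : ℝ) ≤ g := by exact_mod_cast Nat.pos_of_mem_divisors hg
          have hle : (#g.divisors : ℝ) ≤ #q.divisors := by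
            exact_mod_cast card_le_card (Nat.divisors_subset_of_dvd hq (Nat.dvd_of_mem_divisors hg))
          calc (#g.divisors : ℝ) / Real.sqrt g ≤ (#g.divisors : ℝ) / 1 :=
                div_le_div_of_nonneg_left (Nat.cast_nonneg _) one_pos (Real.one_le_sqrt.mpr hg1)
            _ ≤ #q.divisors := by rw [div_one]; exact hle
      _ = (#q.divisors : ℝ) ^ 2 := by rw [sum_const, nsmul_eq_mul, sq]
  have h2 := sum_card_divisors_div_le N
  have hlog : 0 ≤ (1 + Real.log N) ^ 2 := sq_nonneg _
  calc ∑ d ∈ Ioc 0 N, (#d.divisors : ℝ) * Real.sqrt (Nat.gcd d q) / d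
      ≤ ∑ d ∈ Ioc 0 N, G (φ d) := sum_le_sum hterm
    _ = ∑ y ∈ (Ioc 0 N).image φ, G y := (sum_image hinj).symm
    _ ≤ ∑ y ∈ q.divisors ×ˢ Ioc 0 N, G y :=
        sum_le_sum_of_subset_of_nonneg hrange fun y _ _ => hG0 y
    _ = (∑ g ∈ q.divisors, (#g.divisors : ℝ) / Real.sqrt g) *
          ∑ m ∈ Ioc 0 N, (#m.divisors : ℝ) / m := by
        rw [sum_product, sum_mul_sum]
    _ ≤ (#q.divisors : ℝ) ^ 2 * (1 + Real.log N) ^ 2 :=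
        mul_le_mul h1 h2 (sum_nonneg fun m _ => by positivity) (by positivity)

/-- **`∑_{d ≤ N} τ(d) √d ≤ N √N (1 + log N)`.** [folklore] -/
theorem sum_card_divisors_mul_sqrt_le (N : ℕ) :
    ∑ d ∈ Ioc 0 N, (#d.divisors : ℝ) * Real.sqrt d ≤ (N : ℝ) * Real.sqrt N * (1 + Real.log N) := by
  calc ∑ d ∈ Ioc 0 N, (#d.divisors : ℝ) * Real.sqrt d
      ≤ ∑ d ∈ Ioc 0 N, (#d.divisors : ℝ) * Real.sqrt N := by
        refine sum_le_sum fun d hd => mul_le_mul_of_nonneg_left ?_ (Nat.cast_nonneg _)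
        rw [mem_Ioc] at hd
        exact Real.sqrt_le_sqrt (by exact_mod_cast hd.2)
    _ = Real.sqrt N * ∑ d ∈ Ioc 0 N, (#d.divisors : ℝ) := by rw [mul_sum]; simp_rw [mul_comm]
    _ ≤ Real.sqrt N * (N * (1 + Real.log N)) :=
        mul_le_mul_of_nonneg_left (sum_card_divisors_le N) (Real.sqrt_nonneg _)
    _ = (N : ℝ) * Real.sqrt N * (1 + Real.log N) := by ring

/-! ### The bound for the Type I expansion -/

/-- **The two sums over `[1,N]^H`.** For `q ≠ 0`:
`∑_{(d_h)} (∏ τ(d_h)) √((P,q))/P ≤ (τ(q)²(1+log N)²)^{#H}` and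
`∑_{(d_h)} (∏ τ(d_h)) √((P,q)) ≤ (N√N(1+log N))^{#H}`, `P = ∏ d_h`.
[cite: TaoTeravainen2021, §8 ((8.6) and after)] -/
theorem sum_pi_bounds (H : Finset ℕ) {q : ℕ} (hq : q ≠ 0) (N : ℕ) :
    (∑ p ∈ H.pi (fun _ => Ioc 0 N), (∏ a ∈ H.attach, (#(p a.1 a.2).divisors : ℝ)) *
        Real.sqrt (Nat.gcd (∏ a ∈ H.attach, p a.1 a.2) q) / ∏ a ∈ H.attach, (p a.1 a.2 : ℝ) ≤
      ((#q.divisors : ℝ) ^ 2 * (1 + Real.log N) ^ 2) ^ #H) ∧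
    (∑ p ∈ H.pi (fun _ => Ioc 0 N), (∏ a ∈ H.attach, (#(p a.1 a.2).divisors : ℝ)) *
        Real.sqrt (Nat.gcd (∏ a ∈ H.attach, p a.1 a.2) q) ≤
      ((N : ℝ) * Real.sqrt N * (1 + Real.log N)) ^ #H) := by
  have hmem : ∀ p ∈ H.pi (fun _ => Ioc 0 N), ∀ a ∈ H.attach, 1 ≤ p a.1 a.2 := by
    intro p hp a _
    rw [Finset.mem_pi] at hp
    have := hp a.1 a.2
    rw [mem_Ioc] at this
    exact this.1
  constructor
  · calc _ ≤ ∑ p ∈ H.pi (fun _ => Ioc 0 N), ∏ a ∈ H.attach,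
          (#(p a.1 a.2).divisors : ℝ) * Real.sqrt (Nat.gcd (p a.1 a.2) q) / (p a.1 a.2) := by
          refine sum_le_sum fun p hp => ?_
          rw [prod_div_distrib, prod_mul_distrib, mul_div_assoc, mul_div_assoc]
          refine mul_le_mul_of_nonneg_left ?_ (prod_nonneg fun a _ => Nat.cast_nonneg _)
          refine div_le_div_of_nonneg_right (sqrt_gcd_prod_le_prod _ _ hq)
            (prod_nonneg fun a _ => Nat.cast_nonneg _)
      _ = _ := sum_pi_prod_eq_pow H (Ioc 0 N)
          (fun d => (#d.divisors : ℝ) * Real.sqrt (Nat.gcd d q) / d)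
      _ ≤ _ := by
          refine pow_le_pow_left₀ (sum_nonneg fun d _ => by positivity) ?_ _
          exact sum_card_divisors_mul_sqrt_gcd_div_le hq N
  · calc _ ≤ ∑ p ∈ H.pi (fun _ => Ioc 0 N), ∏ a ∈ H.attach,
          (#(p a.1 a.2).divisors : ℝ) * Real.sqrt (p a.1 a.2) := by
          refine sum_le_sum fun p hp => ?_
          rw [prod_mul_distrib]
          refine mul_le_mul_of_nonneg_left ?_ (prod_nonneg fun a _ => Nat.cast_nonneg _)
          exact sqrt_gcd_prod_le_prod_sqrt _ _ q (hmem p hp)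
      _ = _ := sum_pi_prod_eq_pow H (Ioc 0 N) (fun d => (#d.divisors : ℝ) * Real.sqrt d)
      _ ≤ _ := by
          refine pow_le_pow_left₀ (sum_nonneg fun d _ => by positivity) ?_ _
          exact sum_card_divisors_mul_sqrt_le N

/-- **The Type I bound for the correlation of `λ♯_Siegel`** (§8, case `ℓ > 0`, at `k = 0`):
if `|ψ| ≤ M`, `D > 1`, `N + 1 ≥ D`, and the Type I sums obey a Lemma 3.7–type bound
`|∑_{n ≤ x} ∏_h 1_{d_h∣n+h} χ((n+h)/d_h)| ≤ B √((P,q)) (x/(qP) + 1)` for all `(d_h) ∈ [1,N]^H`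
(`P = ∏ d_h`), then
`|∑_{n ≤ x} ∏_h λ♯_Siegel(n+h)| ≤ M^{#H} B ((x/q) (τ(q)²(1+log N)²)^{#H} + (N√N(1+log N))^{#H})`.
[cite: TaoTeravainen2021, §8 (the case ℓ > 0)] -/
theorem abs_sum_prod_sharp_le {q : ℕ} [NeZero q] (χ : DirichletCharacter ℂ q) {ψ : ℝ → ℝ}
    (hψ : IsSmoothCutoff ψ) {M : ℝ} (hM : ∀ u, |ψ u| ≤ M) (R : ℝ) {D : ℝ} (hD : 1 < D) {N : ℕ}
    (hN : D ≤ N + 1) (H : Finset ℕ) (x : ℕ) {B : ℝ} (hB : 0 ≤ B)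
    (hT : ∀ p ∈ H.pi (fun _ => Ioc 0 N),
      |∑ n ∈ Icc 1 x, ∏ a ∈ H.attach,
          (if p a.1 a.2 ∣ n + a.1 then realChar χ ((n + a.1) / p a.1 a.2) else 0)| ≤
        B * Real.sqrt (Nat.gcd (∏ a ∈ H.attach, p a.1 a.2) q) *
          ((x : ℝ) / ((q : ℝ) * ∏ a ∈ H.attach, (p a.1 a.2 : ℝ)) + 1)) :
    |∑ n ∈ Icc 1 x, ∏ h ∈ H, liouvilleSiegelSharp χ ψ R D (n + h)| ≤
      M ^ #H * B * ((x : ℝ) / q * ((#q.divisors : ℝ) ^ 2 * (1 + Real.log N) ^ 2) ^ #H +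
        ((N : ℝ) * Real.sqrt N * (1 + Real.log N)) ^ #H) := by
  have hq : q ≠ 0 := NeZero.ne q
  have hM0 : 0 ≤ M := (abs_nonneg _).trans (hM 0)
  have hq0 : (0 : ℝ) < q := by exact_mod_cast Nat.pos_of_ne_zero hq
  obtain ⟨hS1, hS2⟩ := sum_pi_bounds H hq N
  rw [sum_prod_liouvilleSiegelSharp_eq χ hψ R hD hN H x]
  refine (abs_sum_le_sum_abs _ _).trans ?_
  -- termwise
  have hterm : ∀ p ∈ H.pi (fun _ => Ioc 0 N),
      |(∏ a ∈ H.attach, sharpCoeff χ ψ R D (p a.1 a.2)) *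
          ∑ n ∈ Icc 1 x, ∏ a ∈ H.attach,
            (if p a.1 a.2 ∣ n + a.1 then realChar χ ((n + a.1) / p a.1 a.2) else 0)| ≤
        M ^ #H * B * ((x : ℝ) / q * ((∏ a ∈ H.attach, (#(p a.1 a.2).divisors : ℝ)) *
            Real.sqrt (Nat.gcd (∏ a ∈ H.attach, p a.1 a.2) q) / ∏ a ∈ H.attach, (p a.1 a.2 : ℝ)) +
          (∏ a ∈ H.attach, (#(p a.1 a.2).divisors : ℝ)) *
            Real.sqrt (Nat.gcd (∏ a ∈ H.attach, p a.1 a.2) q)) := by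
    intro p hp
    have hP0 : (0 : ℝ) < ∏ a ∈ H.attach, (p a.1 a.2 : ℝ) := by
      refine prod_pos fun a _ => ?_
      rw [Finset.mem_pi] at hp
      have := hp a.1 a.2
      rw [mem_Ioc] at this
      exact_mod_cast this.1
    rw [abs_mul, Finset.abs_prod]
    have hcoef : ∏ a ∈ H.attach, |sharpCoeff χ ψ R D (p a.1 a.2)| ≤
        M ^ #H * ∏ a ∈ H.attach, (#(p a.1 a.2).divisors : ℝ) := by
      rw [← card_attach, ← prod_const, ← prod_mul_distrib]
      exact prod_le_prod (fun a _ => abs_nonneg _) fun a _ => abs_sharpCoeff_le χ hM R D _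
    set τP := ∏ a ∈ H.attach, (#(p a.1 a.2).divisors : ℝ) with hτP
    set P := ∏ a ∈ H.attach, (p a.1 a.2 : ℝ) with hP
    set G := Real.sqrt (Nat.gcd (∏ a ∈ H.attach, p a.1 a.2) q) with hGdef
    have hτP0 : 0 ≤ τP := prod_nonneg fun a _ => Nat.cast_nonneg _
    calc (∏ a ∈ H.attach, |sharpCoeff χ ψ R D (p a.1 a.2)|) * |∑ n ∈ Icc 1 x, ∏ a ∈ H.attach,
            (if p a.1 a.2 ∣ n + a.1 then realChar χ ((n + a.1) / p a.1 a.2) else 0)|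
        ≤ (M ^ #H * τP) * (B * G * ((x : ℝ) / ((q : ℝ) * P) + 1)) :=
          mul_le_mul hcoef (hT p hp) (abs_nonneg _) (mul_nonneg (pow_nonneg hM0 _) hτP0)
      _ = M ^ #H * B * ((x : ℝ) / q * (τP * G / P) + τP * G) := by ring
  refine (sum_le_sum hterm).trans ?_
  rw [← mul_sum, sum_add_distrib, ← mul_sum]
  refine mul_le_mul_of_nonneg_left (add_le_add ?_ hS2) (mul_nonneg (pow_nonneg hM0 _) hB)
  exact mul_le_mul_of_nonneg_left hS1 (div_nonneg (Nat.cast_nonneg _) hq0.le)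

end Literature.Barriers.Parity.TaoTeravainen
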